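import Summits.ABC.IUTFork.LDHGenuinePerImageSharpRat
import HarnessLib

/-!
# The fork at [IUTchIII] Corollary 3.12, L-DH level, READING (P): the «DS» test implies the «DS+W+I1» test (abc-iut cell, crux
# ThetaPartII = stmt-ABC-19678; row «C:PERIMAGE-DSW-SUFF», bookkeeping companion of part 2)

Record-only PROOF file (D-0012) of the abc-iut cell (branch-C certificate seat abc-iut-C-cert-1, gen 7). TAKES NO SIDE on [IUTchIII]
Cor. 3.12. Pure real arithmetic between the two closed forms at a rational point `q` with pole dictionary `(I, e)`: abc-iut-c312-d1's
`Cor22.cor312PerImageOf_ratPoint_sharp` (p484321) bounds `κ_l·log q^{∤2l}` by `((l+5)/4 − 1)·(Σ_{p∈I, p≠2,l}(1 − 1/m_p)·log p + ½·log 2 + …)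
+ ((l+5)/4)·log π`; part 2's `cor312PerImageOf_ratPoint_sharp_wild` by the same with `(χ_p − 1/m_p)` (`χ_p ∈ {1, 2}`) and `log 2`. Since
`χ_p ≥ 1`, `log p ≥ 0` and `½·log 2 ≤ log 2`, the first inequality implies the second (**`le_sharp_wild_of_le_sharp`**) — the
monotonicity consumed by the branch-C junction «ζ♯ binder ⟹ ζ♯w binder». Nothing here asserts the existence of Θ-data, Cor. 3.12, or abc.
[cite: Mochizuki2012, IUTchIV Thm. 1.10 Step (ii) p. 24, Step (v) p. 27–29] [claim: Mochizuki2012, status: disputed] PROOF-ONLY: no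
definitions, no new `Prop`.
-/

noncomputable section

open NumberField IsDedekindDomain

namespace Literature.IUT.LogVolume.Cor22

open Literature.NumberTheory.DiophantineGeometry.GenEll

variable {q : ℚ} {l : ℕ} {I : Finset ℕ} {e : ℕ → ℕ}

/-- **The «DS» closed form implies the «DS+W+I1» closed form** (same `q`, `l`, pole dictionary): termwise `(1 − 1/m_p)·log p ≤
(χ_p − 1/m_p)·log p` (`χ_p ≥ 1`, `log p ≥ 0` for the primes `p ∈ I`) and `½·log 2 ≤ log 2`, and the common factor `(l+5)/4 − 1 ≥ 0`.
[cite: Mochizuki2012, IUTchIV Thm. 1.10 Step (ii) p. 24] [claim: Mochizuki2012, status: disputed] -/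
theorem le_sharp_wild_of_le_sharp (hI : ∀ p ∈ I, p.Prime)
    (h : (((l : ℝ) + 1) / 24 - 1 / (2 * l)) * logQAvoid (ratPoint q) {2, l} ≤
      (((l : ℝ) + 5) / 4 - 1) *
          ((∑ p ∈ I.filter (fun p => p ≠ 2 ∧ p ≠ l),
              (1 - ((l * Nat.lcm (30 / Nat.gcd 30 (e p)) (if p = 3 then 2 else if p = 5 then 4 else 1) : ℕ) : ℝ)⁻¹)
                * Real.log p)
            + 2⁻¹ * Real.log 2
            + (if 3 ∈ I then 0 else 2⁻¹ * Real.log 3)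
            + (if 5 ∈ I then 0 else (3 / 4 : ℝ) * Real.log 5)
            + (1 - ((l - 1 : ℕ) : ℝ)⁻¹) * Real.log l)
        + ((l : ℝ) + 5) / 4 * Real.log Real.pi) :
    (((l : ℝ) + 1) / 24 - 1 / (2 * l)) * logQAvoid (ratPoint q) {2, l} ≤
      (((l : ℝ) + 5) / 4 - 1) *
          ((∑ p ∈ I.filter (fun p => p ≠ 2 ∧ p ≠ l),
              ((if (p = 3 ∨ p = 5) ∧ 2 ∣ e p ∧ ¬ p ∣ e p / 2 then (2 : ℝ) else 1)
                - ((l * Nat.lcm (30 / Nat.gcd 30 (e p)) (if p = 3 then 2 else if p = 5 then 4 else 1) : ℕ) : ℝ)⁻¹)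
                * Real.log p)
            + Real.log 2
            + (if 3 ∈ I then 0 else 2⁻¹ * Real.log 3)
            + (if 5 ∈ I then 0 else (3 / 4 : ℝ) * Real.log 5)
            + (1 - ((l - 1 : ℕ) : ℝ)⁻¹) * Real.log l)
        + ((l : ℝ) + 5) / 4 * Real.log Real.pi := by
  have hfac : (0 : ℝ) ≤ ((l : ℝ) + 5) / 4 - 1 := by
    have : (0 : ℝ) ≤ l := Nat.cast_nonneg l
    linarith
  have hlog2 : 2⁻¹ * Real.log 2 ≤ Real.log 2 := by
    have : 0 ≤ Real.log 2 := Real.log_nonneg (by norm_num)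
    linarith
  have hsum : ∑ p ∈ I.filter (fun p => p ≠ 2 ∧ p ≠ l),
        (1 - ((l * Nat.lcm (30 / Nat.gcd 30 (e p)) (if p = 3 then 2 else if p = 5 then 4 else 1) : ℕ) : ℝ)⁻¹)
          * Real.log p ≤
      ∑ p ∈ I.filter (fun p => p ≠ 2 ∧ p ≠ l),
        ((if (p = 3 ∨ p = 5) ∧ 2 ∣ e p ∧ ¬ p ∣ e p / 2 then (2 : ℝ) else 1)
          - ((l * Nat.lcm (30 / Nat.gcd 30 (e p)) (if p = 3 then 2 else if p = 5 then 4 else 1) : ℕ) : ℝ)⁻¹)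
          * Real.log p := by
    refine Finset.sum_le_sum fun p hp => ?_
    have hpp : p.Prime := hI p (Finset.mem_filter.mp hp).1
    have hlogp : 0 ≤ Real.log p := Real.log_nonneg (by exact_mod_cast hpp.one_lt.le)
    have hchi : (1 : ℝ) ≤ (if (p = 3 ∨ p = 5) ∧ 2 ∣ e p ∧ ¬ p ∣ e p / 2 then (2 : ℝ) else 1) := by
      split_ifs <;> norm_num
    exact mul_le_mul_of_nonneg_right (by linarith) hlogp
  have hmono := mul_le_mul_of_nonneg_left (add_le_add (add_le_add (add_le_add (add_le_add hsum hlog2)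
    (le_refl (if 3 ∈ I then (0 : ℝ) else 2⁻¹ * Real.log 3))) (le_refl (if 5 ∈ I then (0 : ℝ) else (3 / 4 : ℝ) * Real.log 5)))
    (le_refl ((1 - ((l - 1 : ℕ) : ℝ)⁻¹) * Real.log l))) hfac
  linarith

/-- **The «DS» closed form implies the «DS+W+W2+I⁺» closed form** of part 2b (`cor312PerImageOf_ratPoint_sharp_wild_unit`; same `q`, `l`, pole
dictionary): termwise `1 ≤ χ_p ∈ {1, 1 + 1/p, 2}` with `log p ≥ 0`, and `½·log 2 ≤ (3/2 − 1/lcm(2, ·))·log 2` resp. `≤ log 2` (`lcm(2, ·) ≥ 2`).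
[cite: Mochizuki2012, IUTchIV Thm. 1.10 Step (ii) p. 24] [claim: Mochizuki2012, status: disputed] -/
theorem le_sharp_wild_unit_of_le_sharp (hI : ∀ p ∈ I, p.Prime)
    (h : (((l : ℝ) + 1) / 24 - 1 / (2 * l)) * logQAvoid (ratPoint q) {2, l} ≤
      (((l : ℝ) + 5) / 4 - 1) *
          ((∑ p ∈ I.filter (fun p => p ≠ 2 ∧ p ≠ l),
              (1 - ((l * Nat.lcm (30 / Nat.gcd 30 (e p)) (if p = 3 then 2 else if p = 5 then 4 else 1) : ℕ) : ℝ)⁻¹)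
                * Real.log p)
            + 2⁻¹ * Real.log 2
            + (if 3 ∈ I then 0 else 2⁻¹ * Real.log 3)
            + (if 5 ∈ I then 0 else (3 / 4 : ℝ) * Real.log 5)
            + (1 - ((l - 1 : ℕ) : ℝ)⁻¹) * Real.log l)
        + ((l : ℝ) + 5) / 4 * Real.log Real.pi) :
    (((l : ℝ) + 1) / 24 - 1 / (2 * l)) * logQAvoid (ratPoint q) {2, l} ≤
      (((l : ℝ) + 5) / 4 - 1) *
          ((∑ p ∈ I.filter (fun p => p ≠ 2 ∧ p ≠ l),
              ((if (p = 3 ∨ p = 5) ∧ 2 ∣ e p ∧ ¬ p ∣ e p / 2 then (2 : ℝ)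
                else if (p = 3 ∨ p = 5) ∧ 2 ∣ e p ∧ p ∣ e p / 2 ∧
                  padicValRat p (((jInv q)⁻¹ / (p : ℚ) ^ (e p)) ^ (p - 1) - 1) = 1 then 1 + (p : ℝ)⁻¹ else 1)
                - ((l * Nat.lcm (30 / Nat.gcd 30 (e p)) (if p = 3 then 2 else if p = 5 then 4 else 1) : ℕ) : ℝ)⁻¹)
                * Real.log p)
            + (if 2 ∈ I then (3 : ℝ) / 2 - ((Nat.lcm 2 (30 / Nat.gcd 30 (e 2)) : ℕ) : ℝ)⁻¹ else 1) * Real.log 2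
            + (if 3 ∈ I then 0 else 2⁻¹ * Real.log 3)
            + (if 5 ∈ I then 0 else (3 / 4 : ℝ) * Real.log 5)
            + (1 - ((l - 1 : ℕ) : ℝ)⁻¹) * Real.log l)
        + ((l : ℝ) + 5) / 4 * Real.log Real.pi := by
  have hfac : (0 : ℝ) ≤ ((l : ℝ) + 5) / 4 - 1 := by
    have : (0 : ℝ) ≤ l := Nat.cast_nonneg l
    linarith
  have hlog2 : 2⁻¹ * Real.log 2 ≤
      (if 2 ∈ I then (3 : ℝ) / 2 - ((Nat.lcm 2 (30 / Nat.gcd 30 (e 2)) : ℕ) : ℝ)⁻¹ else 1) * Real.log 2 := by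
    have h0 : 0 ≤ Real.log 2 := Real.log_nonneg (by norm_num)
    refine mul_le_mul_of_nonneg_right ?_ h0
    split_ifs with h2
    · have hm : (2 : ℝ) ≤ ((Nat.lcm 2 (30 / Nat.gcd 30 (e 2)) : ℕ) : ℝ) := by
        exact_mod_cast Nat.le_of_dvd (Nat.lcm_pos (by norm_num)
          (Nat.div_pos (Nat.gcd_le_left _ (by norm_num)) (Nat.gcd_pos_of_pos_left _ (by norm_num)))) (Nat.dvd_lcm_left 2 _)
      have hm0 : (0 : ℝ) < ((Nat.lcm 2 (30 / Nat.gcd 30 (e 2)) : ℕ) : ℝ) := by linarith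
      have : ((Nat.lcm 2 (30 / Nat.gcd 30 (e 2)) : ℕ) : ℝ)⁻¹ ≤ 2⁻¹ := by
        rw [inv_le_inv₀ hm0 (by norm_num)]; exact hm
      linarith
    · norm_num
  have hsum : ∑ p ∈ I.filter (fun p => p ≠ 2 ∧ p ≠ l),
        (1 - ((l * Nat.lcm (30 / Nat.gcd 30 (e p)) (if p = 3 then 2 else if p = 5 then 4 else 1) : ℕ) : ℝ)⁻¹)
          * Real.log p ≤
      ∑ p ∈ I.filter (fun p => p ≠ 2 ∧ p ≠ l),
        ((if (p = 3 ∨ p = 5) ∧ 2 ∣ e p ∧ ¬ p ∣ e p / 2 then (2 : ℝ)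
          else if (p = 3 ∨ p = 5) ∧ 2 ∣ e p ∧ p ∣ e p / 2 ∧
            padicValRat p (((jInv q)⁻¹ / (p : ℚ) ^ (e p)) ^ (p - 1) - 1) = 1 then 1 + (p : ℝ)⁻¹ else 1)
          - ((l * Nat.lcm (30 / Nat.gcd 30 (e p)) (if p = 3 then 2 else if p = 5 then 4 else 1) : ℕ) : ℝ)⁻¹)
          * Real.log p := by
    refine Finset.sum_le_sum fun p hp => ?_
    have hpp : p.Prime := hI p (Finset.mem_filter.mp hp).1
    have hlogp : 0 ≤ Real.log p := Real.log_nonneg (by exact_mod_cast hpp.one_lt.le)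
    have hp0 : (0 : ℝ) ≤ (p : ℝ)⁻¹ := inv_nonneg.mpr (Nat.cast_nonneg p)
    have hchi : (1 : ℝ) ≤ (if (p = 3 ∨ p = 5) ∧ 2 ∣ e p ∧ ¬ p ∣ e p / 2 then (2 : ℝ)
        else if (p = 3 ∨ p = 5) ∧ 2 ∣ e p ∧ p ∣ e p / 2 ∧
          padicValRat p (((jInv q)⁻¹ / (p : ℚ) ^ (e p)) ^ (p - 1) - 1) = 1 then 1 + (p : ℝ)⁻¹ else 1) := by
      split_ifs <;> linarith
    exact mul_le_mul_of_nonneg_right (by linarith) hlogp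
  have hmono := mul_le_mul_of_nonneg_left (add_le_add (add_le_add (add_le_add (add_le_add hsum hlog2)
    (le_refl (if 3 ∈ I then (0 : ℝ) else 2⁻¹ * Real.log 3))) (le_refl (if 5 ∈ I then (0 : ℝ) else (3 / 4 : ℝ) * Real.log 5)))
    (le_refl ((1 - ((l - 1 : ℕ) : ℝ)⁻¹) * Real.log l))) hfac
  linarith

end Literature.IUT.LogVolume.Cor22

end
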